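import Literature.NumberTheory.GaussSums.KummerSector

/-!
# Birth skeleton (BC3) for the split child `ArgIdentity` (X₃) of `ArgLeg` (stmt-QuantumAdvantage-14637)

`ArgIdentity`: `12·p·S_p = √3 · g(χ_p) · T_p` for `p ≡ 1 (3)` prime, `r` the smaller primitive cube root of unity
mod `p`, `g` a primitive root with `g^{(p-1)/3} ≡ r` (so `cubicGaussSum p g = g(χ_p)`), `S_p = Σ_{0<j≤(p-1)/3} χ_p(j)`,
`T_p = Σ_{a<3p} θ̄(a) cot(πa/3p)`, `θ̄ = χ̄_p ψ₃`.  Line (Pólya's finite Fourier expansion): STUB 1 expands the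
partial sum over the additive characters of `𝔽_p` (`Σ_x χ(x) e(xm/p) = χ̄(m) g(χ)`), STUB 2 evaluates the resulting
geometric sums `Σ_{j≤K} e(−jm/p)`, `K = (p−1)/3`, in closed form — the cube roots of unity `e(∓Km/p) = e(∓m/3)e(±m/3p)`
produce the `ψ₃`-twist and `cot(πa/3p)` (the finite form of `L(1, θ̄) = (π/6p) T_p`, Urbanowicz–Williams 2000 Ch. I
Thm 2 being `S_p = (√3/2π) g(χ_p) L(1, θ̄)`).  Numerics (planner scratch/check_identity.py, check_stubs.py): the
identity holds to `1.1e-12` for the 271 primes `p ≡ 1 (3)` below 4000; STUB 2 alone to `9e-14` for `p < 400`.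
-/

set_option linter.dupNamespace false -- `QuantumAdvantage.QuantumAdvantage` is the D-0017 nested layout

namespace Summit.QuantumAdvantage.QuantumAdvantage.Cruxes.ArgLeg.ArgIdentityBirth

open Literature.NumberTheory.GaussSums

/-- The split child, verbatim (defeq to the route decl once installed). -/
def ArgIdentity : Prop :=
  ∀ (p r g : ℕ), p.Prime → p % 3 = 1 → r < p → (r * r + r + 1) % p = 0 → 2 * r + 1 < p → IsPrimitiveRoot (g : ZMod p) (p - 1) → (g : ZMod p) ^ ((p - 1) / 3) = (r : ZMod p) → 12 * (p : ℂ) * (∑ j ∈ Finset.Icc 1 ((p - 1) / 3), (if (j : ZMod p) ^ ((p - 1) / 3) = 1 then (1 : ℂ) else if (j : ZMod p) ^ ((p - 1) / 3) = (r : ZMod p) then Complex.exp (2 * Real.pi * Complex.I / 3) else Complex.exp (2 * Real.pi * Complex.I / 3) ^ 2)) = (Real.sqrt 3 : ℂ) * Literature.NumberTheory.GaussSums.cubicGaussSum p g * ∑ a ∈ Finset.range (3 * p), ((if (a : ZMod p) = 0 then (0 : ℂ) else if (a : ZMod p) ^ ((p - 1) / 3) = 1 then 1 else if (a : ZMod p)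 ^ ((p - 1) / 3) = (r : ZMod p) then Complex.exp (2 * Real.pi * Complex.I / 3) ^ 2 else Complex.exp (2 * Real.pi * Complex.I / 3)) * (if a % 3 = 1 then (1 : ℂ) else if a % 3 = 2 then -1 else 0) * (Real.cot (Real.pi * a / (3 * p)) : ℂ))

/-- The partial sum `S_p(r)` of the ArgLeg statement (verbatim summand). -/
noncomputable def S (p r : ℕ) : ℂ :=
  ∑ j ∈ Finset.Icc 1 ((p - 1) / 3), (if (j : ZMod p) ^ ((p - 1) / 3) = 1 then (1 : ℂ) else if (j : ZMod p) ^ ((p - 1) / 3) = (r : ZMod p) then Complex.exp (2 * Real.pi * Complex.I / 3) else Complex.exp (2 * Real.pi * Complex.I / 3) ^ 2)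

/-- The conjugate cubic character `χ̄_p(a)` (total: `0` at `a ≡ 0`), as in the `T_p` summand. -/
noncomputable def chiBar (p r a : ℕ) : ℂ :=
  if (a : ZMod p) = 0 then (0 : ℂ) else if (a : ZMod p) ^ ((p - 1) / 3) = 1 then 1 else if (a : ZMod p) ^ ((p - 1) / 3) = (r : ZMod p) then Complex.exp (2 * Real.pi * Complex.I / 3) ^ 2 else Complex.exp (2 * Real.pi * Complex.I / 3)

/-- `T_p(r) = Σ_{a<3p} χ̄_p(a) ψ₃(a) cot(πa/3p)` (verbatim summand of the statement). -/
noncomputable def T (p r : ℕ) : ℂ :=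
  ∑ a ∈ Finset.range (3 * p), (chiBar p r a * (if a % 3 = 1 then (1 : ℂ) else if a % 3 = 2 then -1 else 0) * (Real.cot (Real.pi * a / (3 * p)) : ℂ))

/-- The geometric kernel `Σ_{m=1}^{p-1} χ̄_p(m) Σ_{j=1}^{K} e(−jm/p)`, `K = (p-1)/3`. -/
noncomputable def kernelSum (p r : ℕ) : ℂ :=
  ∑ m ∈ Finset.Icc 1 (p - 1), chiBar p r m * ∑ j ∈ Finset.Icc 1 ((p - 1) / 3), Complex.exp (-(2 * Real.pi * Complex.I * (j * m : ℕ) / p))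

/-- STUB 1 (Pólya's finite Fourier expansion of a partial character sum): `S_p = (g(χ_p)/p) · kernelSum`, from Fourier
inversion on `ℤ/p` and `Σ_x χ_p(x) e(xm/p) = χ̄_p(m) g(χ_p)` (`m ≢ 0`), `Σ_x χ_p(x) = 0`; the hypothesis
`g^{(p-1)/3} = r` identifies `cubicChar p g` with the `r`-convention character of `S_p`. [MontgomeryVaughan2007, §9.4] -/
theorem stub_polya_fourier (p r g : ℕ) (hp : p.Prime) (h3 : p % 3 = 1) (hr : r < p) (hr1 : (r * r + r + 1) % p = 0)
    (hr2 : 2 * r + 1 < p) (hg : IsPrimitiveRoot (g : ZMod p) (p - 1)) (hu : (g : ZMod p) ^ ((p - 1) / 3) = (r : ZMod p)) :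
    S p r = cubicGaussSum p g / p * kernelSum p r := by
  sorry

/-- STUB 2 (closed form of the geometric sums — the finite cotangent formula): `12 · kernelSum = √3 · T_p`.
Purely trigonometric given that `χ̄_p` is a cubic character with `χ̄_p(−1) = 1`; the cube roots of unity
`e(−Km/p) = e(−m/3)·e(m/3p)` split `m mod 3` (the `ψ₃`-twist) and `1/(1 − e(−m/p))`-type terms give `cot(πa/3p)`.
Checked numerically to `9e-14` for all `p ≡ 1 (3)` below 400. [UrbanowiczWilliams2000, Ch. I Thm 2 (finite form)] -/
theorem stub_kernel_cot (p r g : ℕ) (hp : p.Prime) (h3 : p % 3 = 1) (hr : r < p) (hr1 : (r * r + r + 1) % p = 0)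
    (hr2 : 2 * r + 1 < p) (hg : IsPrimitiveRoot (g : ZMod p) (p - 1)) (hu : (g : ZMod p) ^ ((p - 1) / 3) = (r : ZMod p)) :
    12 * kernelSum p r = (Real.sqrt 3 : ℂ) * T p r := by
  sorry

/-- COMPOSITION (kernel-checked, no sorry): the two stubs give `ArgIdentity`. -/
theorem ArgIdentity_of
    (h1 : ∀ (p r g : ℕ), p.Prime → p % 3 = 1 → r < p → (r * r + r + 1) % p = 0 → 2 * r + 1 < p →
      IsPrimitiveRoot (g : ZMod p) (p - 1) → (g : ZMod p) ^ ((p - 1) / 3) = (r : ZMod p) →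
      S p r = cubicGaussSum p g / p * kernelSum p r)
    (h2 : ∀ (p r g : ℕ), p.Prime → p % 3 = 1 → r < p → (r * r + r + 1) % p = 0 → 2 * r + 1 < p →
      IsPrimitiveRoot (g : ZMod p) (p - 1) → (g : ZMod p) ^ ((p - 1) / 3) = (r : ZMod p) →
      12 * kernelSum p r = (Real.sqrt 3 : ℂ) * T p r) :
    ArgIdentity := by
  intro p r g hp h3 hr hr1 hr2 hg hu
  have hS := h1 p r g hp h3 hr hr1 hr2 hg hu
  have hK := h2 p r g hp h3 hr hr1 hr2 hg hu
  have hp0 : (p : ℂ) ≠ 0 := by exact_mod_cast hp.ne_zero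
  show 12 * (p : ℂ) * S p r = (Real.sqrt 3 : ℂ) * cubicGaussSum p g * T p r
  rw [hS]
  calc 12 * (p : ℂ) * (cubicGaussSum p g / p * kernelSum p r)
      = cubicGaussSum p g * (12 * kernelSum p r) * ((p : ℂ) / p) := by ring
    _ = (Real.sqrt 3 : ℂ) * cubicGaussSum p g * T p r := by rw [hK, div_self hp0]; ring

end Summit.QuantumAdvantage.QuantumAdvantage.Cruxes.ArgLeg.ArgIdentityBirth
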